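import Literature.AlgebraicGeometry.Motives.AbelianVarietyTorsionProofs
import HarnessLib

/-!
# Abelian varieties of dimension zero; the zero homomorphism is not an isogeny

Small structural facts about abelian varieties `A : Literature.AlgebraicGeometry.Motives.AbelianVariety K`
used in the reduction of Mumford, *Abelian Varieties*, §19, Theorem 3 to the simple case
(`Literature/NumberTheory/DiophantineGeometry/AVIsogenyTateHomPoincareProofs.lean`):

* `AbelianVariety.subsingleton_left_of_dim_eq_zero` — an abelian variety of dimension `0` has a
  single point (`dim` is the topological Krull dimension, `topologicalKrullDim_left`; an irreducible
  `T₀` space of Krull dimension `0` is a point);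
* `AbelianVariety.isIso_unitPt_of_dim_eq_zero` — then the unit section `Spec K → A` is an
  isomorphism (a surjective closed immersion into a reduced scheme);
* `AbelianVariety.hom_eq_zero_of_dim_eq_zero_left/right` — hence `Hom(A, B) = 0` whenever
  `dim A = 0` or `dim B = 0`;
* `AbelianVariety.not_isIsogeny_zero_of_dim_pos` — the zero homomorphism `X → Y` is not an isogeny
  when `dim Y > 0` (its image is the origin).

All statements are standard ([folklore]); no definitions, no named facts.
-/

universe u

open CategoryTheory AlgebraicGeometry TopologicalSpace

noncomputable section

namespace Literature.AlgebraicGeometry.Motives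

namespace AbelianVariety

variable {K : Type u} [Field K]

/-- **An abelian variety of dimension `0` is a single point**: its underlying space is irreducible
and `T₀` of topological Krull dimension `dim A = 0` (`topologicalKrullDim_left`); if a point `x` had
`closure {x} ≠ A` then `closure {x} ⊂ A` would be a chain of irreducible closed subsets of length
`1`; so every point is generic, and generic points of a `T₀` space coincide. [folklore] -/
theorem subsingleton_left_of_dim_eq_zero (A : AbelianVariety K) (h : A.dim = 0) :
    Subsingleton A.X.left := by
  haveI : IrreducibleSpace A.X.left := A.irreducibleSpace_left
  have hdim : topologicalKrullDim A.X.left ≤ 0 := by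
    rw [topologicalKrullDim_left, h]
    exact le_of_eq (by simp)
  have hmax := (Order.krullDim_nonpos_iff_forall_isMax.1 hdim)
  -- every point is generic
  have hgen : ∀ x : A.X.left, closure ({x} : Set A.X.left) = Set.univ := fun x => by
    by_contra hne
    let a : IrreducibleCloseds A.X.left :=
      ⟨closure {x}, isIrreducible_singleton.closure, isClosed_closure⟩
    let b : IrreducibleCloseds A.X.left :=
      ⟨Set.univ, IrreducibleSpace.isIrreducible_univ _, isClosed_univ⟩
    have hab : a < b := by
      refine lt_of_le_of_ne (fun y _ => Set.mem_univ y) fun heq => hne ?_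
      have := congrArg (fun c : IrreducibleCloseds A.X.left => (c : Set A.X.left)) heq
      simpa [a, b] using this
    exact (hmax a).not_lt hab
  refine ⟨fun x y => ?_⟩
  have hxy : Inseparable x y := by
    rw [inseparable_iff_closure_eq, hgen x, hgen y]
  exact hxy.eq

/-- **For `dim A = 0` the unit section `Spec K → A` is an isomorphism**: it is a closed immersion
(`isClosedImmersion_unitPt`), surjective (`A` is a point) and `A` is reduced (Mathlib
`isIso_of_isClosedImmersion_of_surjective`). [folklore] -/
theorem isIso_unitPt_of_dim_eq_zero (A : AbelianVariety K) (h : A.dim = 0) : IsIso (unitPt A) := by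
  haveI := A.subsingleton_left_of_dim_eq_zero h
  haveI : Surjective (unitPt A) :=
    ⟨fun x => ⟨IsLocalRing.closedPoint K, Subsingleton.elim _ _⟩⟩
  exact isIso_of_isClosedImmersion_of_surjective (unitPt A)

/-- For `dim A = 0` the structure morphism `A → Spec K` is an isomorphism (inverse to the unit
section). [folklore] -/
theorem isIso_hom_of_dim_eq_zero (A : AbelianVariety K) (h : A.dim = 0) : IsIso A.X.hom := by
  haveI := A.isIso_unitPt_of_dim_eq_zero h
  haveI : IsIso (unitPt A ≫ A.X.hom) := by
    rw [unitPt_comp_hom]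
    infer_instance
  exact IsIso.of_isIso_comp_left (unitPt A) A.X.hom

/-- **`Hom(X, A) = 0` for `dim A = 0`**: a homomorphism `X → A` is a morphism over `Spec K` into
`A ≅ Spec K`, hence unique. [folklore] -/
theorem hom_eq_zero_of_dim_eq_zero_right {X : AbelianVariety K} (A : AbelianVariety K)
    (h : A.dim = 0) (f : X ⟶ A) : f = 0 := by
  haveI := A.isIso_hom_of_dim_eq_zero h
  apply hom_ext
  apply Over.OverMorphism.ext
  change Hom.toSchemeHom f = Hom.toSchemeHom 0
  rw [← cancel_mono A.X.hom, toSchemeHom_comp_hom, toSchemeHom_comp_hom]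

/-- **`Hom(A, Y) = 0` for `dim A = 0`**: a homomorphism `A → Y` preserves the unit sections
(`unitPt_comp_toSchemeHom`), and the unit section of `A` is an isomorphism. [folklore] -/
theorem hom_eq_zero_of_dim_eq_zero_left {Y : AbelianVariety K} (A : AbelianVariety K)
    (h : A.dim = 0) (f : A ⟶ Y) : f = 0 := by
  haveI := A.isIso_unitPt_of_dim_eq_zero h
  apply hom_ext
  apply Over.OverMorphism.ext
  change Hom.toSchemeHom f = Hom.toSchemeHom 0
  rw [← cancel_epi (unitPt A), unitPt_comp_toSchemeHom, unitPt_comp_toSchemeHom]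

/-- `Hom(X, Y) = 0` as soon as one of `X`, `Y` has dimension `0`. [folklore] -/
theorem hom_eq_zero_of_dim_eq_zero {X Y : AbelianVariety K} (h : X.dim = 0 ∨ Y.dim = 0)
    (f : X ⟶ Y) : f = 0 :=
  h.elim (fun hX => hom_eq_zero_of_dim_eq_zero_left X hX f)
    fun hY => hom_eq_zero_of_dim_eq_zero_right Y hY f

/-- **The zero homomorphism to a positive-dimensional abelian variety is not an isogeny**: its
underlying morphism is `X → Spec K → Y` (the origin), whose image is the single point `0_Y`, so it
is surjective only if `Y` is a point, i.e. `dim Y = 0`. [folklore] -/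
theorem not_isIsogeny_zero_of_dim_pos {X Y : AbelianVariety K} (hY : 0 < Y.dim) :
    ¬ IsIsogeny (0 : X ⟶ Y) := by
  rintro ⟨hsurj, -⟩
  have h0 : Hom.toSchemeHom (0 : X ⟶ Y) = X.X.hom ≫ unitPt Y := by
    change ((0 : X ⟶ Y).hom.hom.hom).left = _
    rw [hom_zero, Grp.Hom.hom_one, Mon.Hom.hom_one, one_left]
  haveI : Subsingleton Y.X.left := ⟨fun a b => by
    obtain ⟨a', rfl⟩ := hsurj.1 a
    obtain ⟨b', rfl⟩ := hsurj.1 b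
    have ha : (Hom.toSchemeHom (0 : X ⟶ Y)).base a' ∈ Set.range (unitPt Y).base :=
      ⟨X.X.hom.base a', by rw [h0]; rfl⟩
    have hb : (Hom.toSchemeHom (0 : X ⟶ Y)).base b' ∈ Set.range (unitPt Y).base :=
      ⟨X.X.hom.base b', by rw [h0]; rfl⟩
    rw [range_unitPt, Set.mem_singleton_iff] at ha hb
    rw [ha, hb]⟩
  have hle := topologicalKrullDim_zero_of_discreteTopology Y.X.left
  rw [topologicalKrullDim_left] at hle
  have : Y.dim ≤ 0 := by exact_mod_cast hle
  omega

end AbelianVariety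

end Literature.AlgebraicGeometry.Motives
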